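import Literature.Probability.Percolation.TriWalkParity
import Literature.Probability.Percolation.TriDiscShelling
import Literature.Probability.Percolation.TriDiscreteDomain
import Literature.Probability.Percolation.TriSepEscape
import Literature.Probability.Percolation.TriSepProbEstimates
import HarnessLib

/-!
# Winding parity of closed lattice chains at faces, and the two sides of a lattice loop

Topic `Literature/Probability/Percolation`; family `crit-perc` (site percolation on the triangular
lattice `𝕋 = triGraph`; faces = triangles of `𝕋` = vertices of the hexagonal lattice,
`HexVertex`). Planar-topology toolkit for the separation arguments of Smirnov's theorem
(Bollobás–Riordan, *Percolation* (2006), Ch. 7: Claim 10 p. 177, Claim 11 p. 179 and the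
proof of Lemma 6 p. 175 all argue with "the cycle `C` winds around `z` but not around `w`",
"every `hᵢ` lies on or outside `C`", i.e. with the Jordan curve theorem for lattice cycles).
As in `TriWalkParity.lean` (whose coordinate identities `zind_rayCross_eq`, `zind_boundary_eq`
are reused) the substitute is a `ℤ/2`-valued crossing number, here attached to FACES and to
closed chains given as vertex LISTS (the closed walks to be used are glued from pieces — a
lattice path and a chain of outer boundary sites — which is painless for lists):

* `pathDarts l`, `cycDarts l` — the darts (consecutive pairs) of a list of sites, resp. its closed
  darts (including the dart from the last entry back to the first); `dsum`, `lRayCount`,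
  `lEdgeParity`, `lbond D x y` (multiplicity mod `2` of the bond `{x, y}` among the darts) and
  the identities `lRayCount_succ`, `lRayCount_boundary` (the flow identity for closed chains).
* `faceLabel D F` — **the label of the face `F`**: the number mod `2` of darts of `D` crossing the
  horizontal ray eastwards from the centroid of `F` (for the down face `(z, 1)` the ray from
  `(z₀ + ⅔, z₁ + ⅔)`, crossing the edges of the ray from `(z₀ + ⅓, z₁ + ⅓)` except the diagonal of
  the cell). **Label rule** (`faceLabel_add_faceLabel_oppFace`): for a closed chain, the labels of
  a face and of its dual neighbour across a side differ by the multiplicity of the bond spanned by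
  that side; hence labels are constant along chains of dual steps across bonds of multiplicity
  `0` (`faceLabel_eq_of_adj`, `faceLabel_eq_of_reflTransGen_dualStep`: along `DualStep G B`-chains
  when every bond of the chain inside `G` is forbidden).
* `cellLabel D z` — the label of a cell (site): for sites off the chain the common label of the
  six faces at it (`faceLabel_eq_cellLabel_of_mem`), constant along paths of sites off the chain
  (`cellLabel_eq_of_pathIn`, Bollobás–Riordan Ch. 5 p. 131: "an open path cannot start inside and
  end outside a closed cycle"), `0` far to the east (`cellLabel_eq_zero_of_forall_le`).
* `IsTriLoop l` — a lattice cycle (distinct sites, at least three, cyclically adjacent);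
  `leftLabel l`; **the two sides of a loop** (`IsTriLoop.faceLabel_leftFace`,
  `IsTriLoop.faceLabel_rightFace`): every face to the left of a dart of the loop
  (`leftFace`, `TriDiscShelling.lean`) has the label `leftLabel l`, every face to the right has
  `leftLabel l + 1` — by turning about each site of the loop through the bonds at it that are not
  the two bonds of the loop (`faceLabel_leftFace_in_eq_out`), every bond of the loop having
  multiplicity one (`lbond_eq_one`, a loop never traverses a bond both ways).
* `TriMarkedDomain.bdryHead`, `headsList`, `chordLoop` — the chain of outer heads of the boundary
  darts of a discrete domain over a range of positions (consecutive repetitions removed) and the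
  closed chain "lattice path + outer heads" used to close a chord of the domain outside it (its
  properties — a lattice loop whose bonds inside the domain are the bonds of the path — are
  proved where the domains' head blocks are available).

Design. Everything is elementary bookkeeping; no definition here carries mathematical content
beyond the source's "winding" (the label of a face is the winding number of the chain about it,
mod `2`). Lists rather than `SimpleGraph.Walk`: the chains to be closed up are concatenations of
heterogeneous pieces. Junk: `faceLabel`/`leftLabel` are defined for every list; the theorems
carry the hypotheses (`cycDarts` adjacency, `IsTriLoop`).

## References

* B. Bollobás, O. Riordan, *Percolation*, Cambridge University Press (2006), Ch. 5 p. 131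
  (cycles of `T` separate); Ch. 7 pp. 175–179 (winding arguments in the proofs of Lemma 6,
  Claims 10–11).
* H. Kesten, *Percolation theory for mathematicians*, Birkhäuser (1982), §2.2–2.3.

## Mathlib / tree

Mathlib: `List` API (`getElem`, `Nodup.getElem_inj_iff`, `append_of_mem`), `Sym2`, `ZMod 2`.
Tree: `RayCross`, `IsVEdge/IsHEdge/IsDEdge`, `zind`, `zind_rayCross_eq`, `zind_boundary_eq`
(`TriWalkParity.lean`); `triDir`, `leftFaceDir`, `leftFace`, `faceVertex`, `faceDartDir`,
`hexFaceVertices_leftFace`, `exists_eq_faceVertex_of_adj` (`TriDiscShelling.lean`); `oppFace`,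
`faceEdge`, `DualStep`, `triBdryIter` (`TriDiscreteDomain.lean`); `faceEdge_leftFaceDir_succ`,
`hexGraph_adj_leftFaceDir_succ`, `fin6_ofNat_succ`, `exists_eq_leftFaceDir_of_mem`
(`TriSepEscape.lean`); `exists_oppFace_eq_of_hexGraph_adj` (`TriSepProbEstimates.lean`).
Mathlib has no planar topology of lattice paths.
-/

namespace Literature.Probability.Percolation

open LatticeModels Finset

/-! ### Darts of a vertex list -/

/-- The darts (consecutive ordered pairs) of a list of sites. [folklore] -/
def pathDarts : List (Site 2) → List (Site 2 × Site 2)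
  | [] => []
  | [_] => []
  | a :: b :: t => (a, b) :: pathDarts (b :: t)

/-- `pathDarts` of the empty list. [folklore] -/
@[simp] theorem pathDarts_nil : pathDarts [] = [] := rfl

/-- `pathDarts` of a singleton. [folklore] -/
@[simp] theorem pathDarts_singleton (a : Site 2) : pathDarts [a] = [] := rfl

/-- `pathDarts` of a list with at least two elements. [folklore] -/
@[simp] theorem pathDarts_cons_cons (a b : Site 2) (t : List (Site 2)) :
    pathDarts (a :: b :: t) = (a, b) :: pathDarts (b :: t) := rfl

/-- The tails of the darts are the list without its last element. [folklore] -/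
theorem map_fst_pathDarts : ∀ l : List (Site 2), (pathDarts l).map Prod.fst = l.dropLast
  | [] => rfl
  | [_] => rfl
  | a :: b :: t => by
    rw [pathDarts_cons_cons, List.map_cons, map_fst_pathDarts (b :: t), List.dropLast_cons_cons]

/-- The heads of the darts are the tail of the list. [folklore] -/
theorem map_snd_pathDarts : ∀ l : List (Site 2), (pathDarts l).map Prod.snd = l.tail
  | [] => rfl
  | [_] => rfl
  | a :: b :: t => by
    rw [pathDarts_cons_cons, List.map_cons, map_snd_pathDarts (b :: t)]; rfl

/-- The endpoints of a dart are entries of the list. [folklore] -/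
theorem mem_of_mem_pathDarts : ∀ {l : List (Site 2)} {d : Site 2 × Site 2}, d ∈ pathDarts l →
    d.1 ∈ l ∧ d.2 ∈ l
  | [], _, h => by simp at h
  | [_], _, h => by simp at h
  | a :: b :: t, d, h => by
    rw [pathDarts_cons_cons, List.mem_cons] at h
    rcases h with rfl | h
    · exact ⟨by simp, by simp⟩
    · obtain ⟨h1, h2⟩ := mem_of_mem_pathDarts h
      exact ⟨List.mem_cons_of_mem _ h1, List.mem_cons_of_mem _ h2⟩

/-- The darts of a list whose consecutive entries are adjacent are darts of `𝕋`. [folklore] -/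
theorem adj_of_mem_pathDarts : ∀ {l : List (Site 2)}, List.IsChain triGraph.Adj l →
    ∀ d ∈ pathDarts l, triGraph.Adj d.1 d.2
  | [], _, d, h => by simp at h
  | [_], _, d, h => by simp at h
  | a :: b :: t, hc, d, h => by
    rw [pathDarts_cons_cons, List.mem_cons] at h
    rcases h with rfl | h
    · exact (List.isChain_cons_cons.1 hc).1
    · exact adj_of_mem_pathDarts (List.isChain_cons_cons.1 hc).2 d h

/-- **The closed darts of a list of sites**: its darts together with the dart from the last
entry back to the first (the darts of `l ++ [l.head]`). [folklore] -/
def cycDarts : List (Site 2) → List (Site 2 × Site 2)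
  | [] => []
  | a :: t => pathDarts (a :: t ++ [a])

/-- The endpoints of a closed dart are entries of the list. [folklore] -/
theorem mem_of_mem_cycDarts {l : List (Site 2)} {d : Site 2 × Site 2} (h : d ∈ cycDarts l) :
    d.1 ∈ l ∧ d.2 ∈ l := by
  cases l with
  | nil => simp [cycDarts] at h
  | cons a t =>
    obtain ⟨h1, h2⟩ := mem_of_mem_pathDarts h
    have key : ∀ x, x ∈ a :: t ++ [a] → x ∈ a :: t := by
      intro x hx
      rw [List.mem_append, List.mem_singleton] at hx
      rcases hx with hx | rfl
      · exact hx
      · exact List.mem_cons_self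
    exact ⟨key _ h1, key _ h2⟩

/-! ### Sums over dart lists -/

/-- The sum of `f` over a list of darts, in `ℤ/2`. [folklore] -/
def dsum (f : Site 2 → Site 2 → ZMod 2) (D : List (Site 2 × Site 2)) : ZMod 2 :=
  (D.map fun d => f d.1 d.2).sum

/-- `dsum` over the empty list. [folklore] -/
@[simp] theorem dsum_nil (f : Site 2 → Site 2 → ZMod 2) : dsum f [] = 0 := rfl

/-- `dsum` over a cons. [folklore] -/
@[simp] theorem dsum_cons (f : Site 2 → Site 2 → ZMod 2) (d : Site 2 × Site 2) (D : List (Site 2 × Site 2)) :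
    dsum f (d :: D) = f d.1 d.2 + dsum f D := by
  simp [dsum]

/-- `dsum` is additive in the summand. [folklore] -/
theorem dsum_add (f g : Site 2 → Site 2 → ZMod 2) (D : List (Site 2 × Site 2)) :
    dsum (fun x y => f x y + g x y) D = dsum f D + dsum g D := by
  induction D with
  | nil => simp
  | cons d D ih => rw [dsum_cons, dsum_cons, dsum_cons, ih]; abel

/-- Summands agreeing on the darts have equal sums. [folklore] -/
theorem dsum_congr {f g : Site 2 → Site 2 → ZMod 2} {D : List (Site 2 × Site 2)}
    (h : ∀ d ∈ D, f d.1 d.2 = g d.1 d.2) : dsum f D = dsum g D := by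
  induction D with
  | nil => rfl
  | cons d D ih =>
    rw [dsum_cons, dsum_cons, h d (by simp), ih fun d' hd' => h d' (by simp [hd'])]

/-- A summand vanishing on the darts has zero sum. [folklore] -/
theorem dsum_eq_zero {f : Site 2 → Site 2 → ZMod 2} {D : List (Site 2 × Site 2)}
    (h : ∀ d ∈ D, f d.1 d.2 = 0) : dsum f D = 0 := by
  rw [dsum_congr (g := fun _ _ => 0) h]
  induction D with
  | nil => rfl
  | cons d D ih => rw [dsum_cons, ih (fun d' hd' => h d' (by simp [hd'])), add_zero]

/-- A sum of a function of the tail over the darts of a list is the sum over the list without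
its last entry. [folklore] -/
theorem dsum_fst (g : Site 2 → ZMod 2) (l : List (Site 2)) :
    dsum (fun x _ => g x) (pathDarts l) = (l.dropLast.map g).sum := by
  unfold dsum
  rw [← map_fst_pathDarts, List.map_map]; rfl

/-- A sum of a function of the head over the darts of a list is the sum over its tail. [folklore] -/
theorem dsum_snd (g : Site 2 → ZMod 2) (l : List (Site 2)) :
    dsum (fun _ y => g y) (pathDarts l) = (l.tail.map g).sum := by
  unfold dsum
  rw [← map_snd_pathDarts, List.map_map]; rfl

/-- **A closed chain enters and leaves any set an even number of times**: summing
`[x ∈ S] + [y ∈ S]` over the closed darts `x → y` of a list gives `0`. [folklore] -/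
theorem dsum_boundary_cycDarts (s : Site 2 → Prop) [DecidablePred s] (l : List (Site 2)) :
    dsum (fun x y => zind (s x) + zind (s y)) (cycDarts l) = 0 := by
  cases l with
  | nil => rfl
  | cons a t =>
    show dsum (fun x y => zind (s x) + zind (s y)) (pathDarts (a :: t ++ [a])) = 0
    rw [dsum_add, dsum_fst (fun x => zind (s x)), dsum_snd (fun y => zind (s y)),
      show (a :: t ++ [a]).dropLast = a :: t from List.dropLast_concat, List.cons_append, List.tail_cons,
      List.map_append, List.sum_append, List.map_cons, List.sum_cons, List.map_cons, List.map_nil,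
      List.sum_cons, List.sum_nil, add_zero, add_comm (zind (s a)) ((t.map fun x => zind (s x)).sum),
      CharTwo.add_self_eq_zero]

/-! ### Ray crossings of dart lists -/

/-- The number modulo `2` of darts of `D` crossing the ray from `(a + ⅓, b + ⅓)` eastwards
(`RayCross`, `TriWalkParity.lean`). [folklore] -/
def lRayCount (D : List (Site 2 × Site 2)) (a b : ℤ) : ZMod 2 := dsum (fun x y => zind (RayCross a b x y)) D

/-- The multiplicity modulo `2` in `D` of the edges described by `E`. [folklore] -/
def lEdgeParity (E : Site 2 → Site 2 → Prop) [DecidableRel E] (D : List (Site 2 × Site 2)) : ZMod 2 :=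
  dsum (fun x y => zind (E x y)) D

/-- Moving the ray one unit to the right drops the diagonal and the vertical edge of the cell
(`zind_rayCross_eq`). [folklore] -/
theorem lRayCount_succ (D : List (Site 2 × Site 2)) (a b : ℤ) :
    lRayCount D a b = lRayCount D (a + 1) b + lEdgeParity (IsDEdge a b) D + lEdgeParity (IsVEdge (a + 1) b) D := by
  unfold lRayCount lEdgeParity
  rw [← dsum_add, ← dsum_add]
  exact dsum_congr fun d _ => zind_rayCross_eq a b d.1 d.2

/-- **The flow identity for a closed chain** (`zind_boundary_eq` summed over the closed darts,
which cross the boundary of the quadrant `{x₁ = b + 1, x₀ ≥ a + 1}` an even number of times). [folklore] -/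
theorem lRayCount_boundary {l : List (Site 2)} (hadj : ∀ d ∈ cycDarts l, triGraph.Adj d.1 d.2) (a b : ℤ) :
    lRayCount (cycDarts l) a (b + 1) + lRayCount (cycDarts l) (a + 1) b +
      lEdgeParity (IsHEdge a (b + 1)) (cycDarts l) + lEdgeParity (IsVEdge (a + 1) b) (cycDarts l) = 0 := by
  have key : lEdgeParity (IsHEdge a (b + 1)) (cycDarts l) + lRayCount (cycDarts l) a (b + 1) +
      lRayCount (cycDarts l) (a + 1) b + lEdgeParity (IsVEdge (a + 1) b) (cycDarts l) =
      dsum (fun x y => zind (x 1 = b + 1 ∧ a + 1 ≤ x 0) + zind (y 1 = b + 1 ∧ a + 1 ≤ y 0)) (cycDarts l) := by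
    unfold lRayCount lEdgeParity
    rw [← dsum_add, ← dsum_add, ← dsum_add]
    exact dsum_congr fun d hd => (zind_boundary_eq (hadj d hd)).symm
  rw [dsum_boundary_cycDarts] at key
  rw [← key]; abel

/-! ### Bond multiplicities -/

/-- The multiplicity modulo `2` of the bond `{x, y}` among the darts of `D`. [folklore] -/
def lbond (D : List (Site 2 × Site 2)) (x y : Site 2) : ZMod 2 := dsum (fun p q => zind (s(p, q) = s(x, y))) D

/-- `lbond` is symmetric in the bond. [folklore] -/
theorem lbond_comm (D : List (Site 2 × Site 2)) (x y : Site 2) : lbond D x y = lbond D y x := by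
  unfold lbond
  exact dsum_congr fun d _ => zind_congr (by rw [Sym2.eq_swap (a := x)])

/-- A bond none of whose endpoints... : if no dart of `D` has the endpoint `x`, the bond `{x, y}`
has multiplicity `0`. [folklore] -/
theorem lbond_eq_zero_of_forall_ne {D : List (Site 2 × Site 2)} {x : Site 2}
    (h : ∀ d ∈ D, d.1 ≠ x ∧ d.2 ≠ x) (y : Site 2) : lbond D x y = 0 := by
  refine dsum_eq_zero fun d hd => zind_of_neg fun he => ?_
  have hx : x ∈ s(d.1, d.2) := by rw [he]; exact Sym2.mem_mk_left _ _
  rcases Sym2.mem_iff.1 hx with hx | hx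
  · exact (h d hd).1 hx.symm
  · exact (h d hd).2 hx.symm

/-- The bond `{x, y}` has multiplicity `0` if it is not the bond of any dart of `D`. [folklore] -/
theorem lbond_eq_zero_of_forall_sym2_ne {D : List (Site 2 × Site 2)} {x y : Site 2}
    (h : ∀ d ∈ D, s(d.1, d.2) ≠ s(x, y)) : lbond D x y = 0 :=
  dsum_eq_zero fun d hd => zind_of_neg (h d hd)

/-- The vertical edge of the cell `z` is the bond `{z, z + e₁}`. [folklore] -/
theorem isVEdge_iff_sym2_eq (z p q : Site 2) :
    IsVEdge (z 0) (z 1) p q ↔ s(p, q) = s(z, z + Pi.single 1 1) := by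
  rw [Sym2.eq_iff]
  unfold IsVEdge
  simp only [Site.eq_iff_two, Pi.add_apply, Pi.single_apply]
  simp
  omega

/-- The horizontal edge of the cell `z` is the bond `{z, z + e₀}`. [folklore] -/
theorem isHEdge_iff_sym2_eq (z p q : Site 2) :
    IsHEdge (z 0) (z 1) p q ↔ s(p, q) = s(z, z + Pi.single 0 1) := by
  rw [Sym2.eq_iff]
  unfold IsHEdge
  simp only [Site.eq_iff_two, Pi.add_apply, Pi.single_apply]
  simp
  omega

/-- The diagonal of the cell `z` is the bond `{z + e₁, z + e₀}`. [folklore] -/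
theorem isDEdge_iff_sym2_eq (z p q : Site 2) :
    IsDEdge (z 0) (z 1) p q ↔ s(p, q) = s(z + Pi.single 1 1, z + Pi.single 0 1) := by
  rw [Sym2.eq_iff]
  unfold IsDEdge
  simp only [Site.eq_iff_two, Pi.add_apply, Pi.single_apply]
  simp
  omega

/-- The multiplicity of the vertical edge of the cell `z` is that of the bond `{z, z + e₁}`. [folklore] -/
theorem lEdgeParity_isVEdge (D : List (Site 2 × Site 2)) (z : Site 2) :
    lEdgeParity (IsVEdge (z 0) (z 1)) D = lbond D z (z + Pi.single 1 1) :=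
  dsum_congr fun d _ => zind_congr (isVEdge_iff_sym2_eq z d.1 d.2)

/-- The multiplicity of the horizontal edge of the cell `z` is that of the bond `{z, z + e₀}`. [folklore] -/
theorem lEdgeParity_isHEdge (D : List (Site 2 × Site 2)) (z : Site 2) :
    lEdgeParity (IsHEdge (z 0) (z 1)) D = lbond D z (z + Pi.single 0 1) :=
  dsum_congr fun d _ => zind_congr (isHEdge_iff_sym2_eq z d.1 d.2)

/-- The multiplicity of the diagonal of the cell `z` is that of the bond `{z + e₁, z + e₀}`. [folklore] -/
theorem lEdgeParity_isDEdge (D : List (Site 2 × Site 2)) (z : Site 2) :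
    lEdgeParity (IsDEdge (z 0) (z 1)) D = lbond D (z + Pi.single 1 1) (z + Pi.single 0 1) :=
  dsum_congr fun d _ => zind_congr (isDEdge_iff_sym2_eq z d.1 d.2)

/-! ### Face labels -/

/-- **The label of a face** with respect to the dart list `D` (meaningful for the closed darts
of a chain): the number modulo `2` of darts crossing the horizontal ray eastwards from the
centroid of the face — for the up face `(z, 0)` the ray from `(z₀ + ⅓, z₁ + ⅓)` (`lRayCount`),
for the down face `(z, 1)` the ray from `(z₀ + ⅔, z₁ + ⅔)`, which crosses the same edges except
the diagonal of the cell `z`. For a closed chain this is its winding number around the face,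
modulo `2`. [folklore] -/
def faceLabel (D : List (Site 2 × Site 2)) (F : HexVertex) : ZMod 2 :=
  if F.2 = 0 then lRayCount D (F.1 0) (F.1 1)
  else lRayCount D (F.1 0) (F.1 1) + lEdgeParity (IsDEdge (F.1 0) (F.1 1)) D

/-- The label of an up face. [folklore] -/
theorem faceLabel_up (D : List (Site 2 × Site 2)) (z : Site 2) :
    faceLabel D (z, 0) = lRayCount D (z 0) (z 1) := if_pos rfl

/-- The label of a down face. [folklore] -/
theorem faceLabel_down (D : List (Site 2 × Site 2)) (z : Site 2) :
    faceLabel D (z, 1) = lRayCount D (z 0) (z 1) + lEdgeParity (IsDEdge (z 0) (z 1)) D :=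
  if_neg (show ¬ ((1 : Fin 2) = 0) by decide)

/-- In `ℤ/2`: `a + (a + b) = b`. [folklore] -/
theorem zmod_two_add_add_cancel (a b : ZMod 2) : a + (a + b) = b := by revert a b; decide

/-- Across the diagonal of the cell `z`: the labels of `(z, 0)` and `(z, 1)` differ by the
multiplicity of the bond `{z + e₁, z + e₀}`. [folklore] -/
theorem faceLabel_up_add_down (D : List (Site 2 × Site 2)) (z : Site 2) :
    faceLabel D (z, 0) + faceLabel D (z, 1) = lbond D (z + Pi.single 1 1) (z + Pi.single 0 1) := by
  rw [faceLabel_up, faceLabel_down, zmod_two_add_add_cancel, lEdgeParity_isDEdge]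

/-- Across the vertical edge of the cell `z`: the labels of `(z, 0)` and `(z - e₀, 1)` differ by
the multiplicity of the bond `{z, z + e₁}`. [folklore] -/
theorem faceLabel_up_add_down_left (D : List (Site 2 × Site 2)) (z : Site 2) :
    faceLabel D (z, 0) + faceLabel D (z - Pi.single 0 1, 1) = lbond D z (z + Pi.single 1 1) := by
  rw [faceLabel_up, faceLabel_down, ← lEdgeParity_isVEdge]
  have h0 : (z - Pi.single 0 1 : Site 2) 0 = z 0 - 1 := by simp
  have h1 : (z - Pi.single 0 1 : Site 2) 1 = z 1 := by simp
  rw [h0, h1, lRayCount_succ D (z 0 - 1) (z 1), sub_add_cancel]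
  have key : ∀ R E V : ZMod 2, R + (R + E + V + E) = V := by decide
  exact key _ _ _

/-- Across the horizontal edge of the cell `z`, for a closed chain: the labels of `(z, 0)` and
`(z - e₁, 1)` differ by the multiplicity of the bond `{z, z + e₀}`. [folklore] -/
theorem faceLabel_up_add_down_below {l : List (Site 2)} (hadj : ∀ d ∈ cycDarts l, triGraph.Adj d.1 d.2)
    (z : Site 2) :
    faceLabel (cycDarts l) (z, 0) + faceLabel (cycDarts l) (z - Pi.single 1 1, 1) =
      lbond (cycDarts l) z (z + Pi.single 0 1) := by
  rw [faceLabel_up, faceLabel_down, ← lEdgeParity_isHEdge]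
  have h0 : (z - Pi.single 1 1 : Site 2) 0 = z 0 := by simp
  have h1 : (z - Pi.single 1 1 : Site 2) 1 = z 1 - 1 := by simp
  rw [h0, h1]
  have hs := lRayCount_succ (cycDarts l) (z 0) (z 1 - 1)
  have hb := lRayCount_boundary hadj (z 0) (z 1 - 1)
  rw [sub_add_cancel] at hb
  have key : ∀ R R' Rs D V H : ZMod 2, R' = Rs + D + V → R + Rs + H + V = 0 → R + (R' + D) = H := by decide
  exact key _ _ _ _ _ _ hs hb

/-- **The label rule across a side of a face**, for the closed darts of a chain: the labels of a
face and of its dual neighbour across the side opposite the `j`-th vertex differ by the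
multiplicity of the bond spanned by the two other vertices. [folklore] -/
theorem faceLabel_add_faceLabel_oppFace {l : List (Site 2)} (hadj : ∀ d ∈ cycDarts l, triGraph.Adj d.1 d.2)
    (F : HexVertex) (j : Fin 3) :
    faceLabel (cycDarts l) F + faceLabel (cycDarts l) (oppFace F j) =
      lbond (cycDarts l) (faceVertex F (j + 1)) (faceVertex F (j + 2)) := by
  rcases F with ⟨x, t⟩
  by_cases ht : t = 0
  · subst ht
    fin_cases j
    · simpa [oppFace, faceVertex, lbond_comm (cycDarts l) (x + Pi.single 0 1)] using
        faceLabel_up_add_down (cycDarts l) x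
    · simpa [oppFace, faceVertex, lbond_comm (cycDarts l) (x + Pi.single 1 1)] using
        faceLabel_up_add_down_left (cycDarts l) x
    · simpa [oppFace, faceVertex] using faceLabel_up_add_down_below hadj x
  · obtain rfl : t = 1 := by
      rcases Fin.exists_fin_two.1 ⟨t, rfl⟩ with h' | h'
      · exact (ht h').elim
      · exact h'
    fin_cases j
    · have := faceLabel_up_add_down_below hadj (x + Pi.single 1 1)
      rw [add_sub_cancel_right, add_comm] at this
      simpa [oppFace, faceVertex, add_assoc, add_comm (Pi.single 0 1 : Site 2) (Pi.single 1 1),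
        lbond_comm (cycDarts l) (x + (Pi.single 1 1 + Pi.single 0 1))] using this
    · have := faceLabel_up_add_down (cycDarts l) x
      rw [add_comm] at this
      simpa [oppFace, faceVertex] using this
    · have := faceLabel_up_add_down_left (cycDarts l) (x + Pi.single 0 1)
      rw [add_sub_cancel_right, add_comm] at this
      simpa [oppFace, faceVertex, add_assoc, add_comm (Pi.single 0 1 : Site 2) (Pi.single 1 1)] using this

/-! ### The shared side of a face and its dual neighbour -/

/-- The side shared by `F` and its dual neighbour opposite the `j`-th vertex is spanned by the
two other vertices. [folklore] -/
theorem faceEdge_oppFace (F : HexVertex) (j : Fin 3) :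
    faceEdge F (oppFace F j) = {faceVertex F (j + 1), faceVertex F (j + 2)} := by
  rcases F with ⟨x, t⟩
  ext z
  simp only [faceEdge, Finset.mem_inter, Finset.mem_insert, Finset.mem_singleton]
  by_cases ht : t = 0
  · subst ht
    fin_cases j <;>
      simp [oppFace, faceVertex, mem_hexFaceVertices_zero, mem_hexFaceVertices_one, Site.eq_iff_two] <;> omega
  · obtain rfl : t = 1 := by
      rcases Fin.exists_fin_two.1 ⟨t, rfl⟩ with h' | h'
      · exact (ht h').elim
      · exact h'
    fin_cases j <;>
      simp [oppFace, faceVertex, mem_hexFaceVertices_zero, mem_hexFaceVertices_one, Site.eq_iff_two] <;> omega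

/-- **Adjacent faces across a bond of multiplicity `0` have equal labels.** [folklore] -/
theorem faceLabel_eq_of_adj {l : List (Site 2)} (hadj : ∀ d ∈ cycDarts l, triGraph.Adj d.1 d.2)
    {F F' : HexVertex} (hFF' : hexGraph.Adj F F')
    (hB : ∀ x y, faceEdge F F' = {x, y} → lbond (cycDarts l) x y = 0) :
    faceLabel (cycDarts l) F = faceLabel (cycDarts l) F' := by
  obtain ⟨j, rfl⟩ := exists_oppFace_eq_of_hexGraph_adj hFF'
  have h := faceLabel_add_faceLabel_oppFace hadj F j
  rw [hB _ _ (faceEdge_oppFace F j)] at h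
  have key : ∀ a b : ZMod 2, a + b = 0 → a = b := by decide
  exact key _ _ h

/-- **Labels are constant along dual paths not crossing the chain**: if every bond of the closed
chain with both endpoints in `G` is forbidden, then the label is constant along chains of dual
steps of `G` avoiding the forbidden bonds. [folklore] -/
theorem faceLabel_eq_of_reflTransGen_dualStep {l : List (Site 2)} (hadj : ∀ d ∈ cycDarts l, triGraph.Adj d.1 d.2)
    {G : Finset (Site 2)} {B : Set (Sym2 (Site 2))}
    (hcov : ∀ d ∈ cycDarts l, d.1 ∈ G → d.2 ∈ G → s(d.1, d.2) ∈ B) {F F' : HexVertex}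
    (h : Relation.ReflTransGen (DualStep G B) F F') : faceLabel (cycDarts l) F = faceLabel (cycDarts l) F' := by
  induction h with
  | refl => rfl
  | tail _ hstep ih =>
    rw [ih]
    obtain ⟨hadj', hsub, hnot⟩ := hstep
    refine faceLabel_eq_of_adj hadj hadj' fun x y hxy => lbond_eq_zero_of_forall_sym2_ne fun d hd he => ?_
    have hx : x ∈ G := hsub (by rw [hxy]; simp)
    have hy : y ∈ G := hsub (by rw [hxy]; simp)
    have h1 : d.1 ∈ G := by
      have : d.1 ∈ s(x, y) := by rw [← he]; exact Sym2.mem_mk_left _ _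
      rcases Sym2.mem_iff.1 this with h' | h' <;> (rw [h']; assumption)
    have h2 : d.2 ∈ G := by
      have : d.2 ∈ s(x, y) := by rw [← he]; exact Sym2.mem_mk_right _ _
      rcases Sym2.mem_iff.1 this with h' | h' <;> (rw [h']; assumption)
    exact hnot x y hxy (he ▸ hcov d hd h1 h2)

/-! ### Cell labels -/

/-- **The label of a cell** (site) `z`: the label of its up face `(z, 0)` — for sites off the
chain, the common label of the six faces at `z` (`faceLabel_eq_cellLabel_of_mem`); it is the
`windParity` of `TriWalkParity.lean` transcribed to dart lists. [folklore] -/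
def cellLabel (D : List (Site 2 × Site 2)) (z : Site 2) : ZMod 2 := faceLabel D (z, 0)

/-- All six faces at a site off the chain have the label of the cell (rotating about the site
crosses only bonds at it, of multiplicity `0`). [folklore] -/
theorem faceLabel_leftFaceDir_eq_cellLabel {l : List (Site 2)} (hadj : ∀ d ∈ cycDarts l, triGraph.Adj d.1 d.2)
    {z : Site 2} (hz : ∀ d ∈ cycDarts l, d.1 ≠ z ∧ d.2 ≠ z) (k : Fin 6) :
    faceLabel (cycDarts l) (leftFaceDir z k) = cellLabel (cycDarts l) z := by
  have key : ∀ n : ℕ, faceLabel (cycDarts l) (leftFaceDir z (Fin.ofNat 6 n)) = cellLabel (cycDarts l) z := by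
    intro n
    induction n with
    | zero => rfl
    | succ n ih =>
      rw [← ih, fin6_ofNat_succ]
      refine (faceLabel_eq_of_adj hadj (hexGraph_adj_leftFaceDir_succ z _) fun x y hxy => ?_).symm
      rw [faceEdge_leftFaceDir_succ] at hxy
      have hzmem : z ∈ ({x, y} : Finset (Site 2)) := by rw [← hxy]; simp
      simp only [Finset.mem_insert, Finset.mem_singleton] at hzmem
      rcases hzmem with rfl | rfl
      · exact lbond_eq_zero_of_forall_ne hz y
      · rw [lbond_comm]; exact lbond_eq_zero_of_forall_ne hz x
  have := key k.val
  rwa [fin6_ofNat_val] at this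

/-- A face containing a site off the chain has the label of that cell. [folklore] -/
theorem faceLabel_eq_cellLabel_of_mem {l : List (Site 2)} (hadj : ∀ d ∈ cycDarts l, triGraph.Adj d.1 d.2)
    {z : Site 2} (hz : ∀ d ∈ cycDarts l, d.1 ≠ z ∧ d.2 ≠ z) {F : HexVertex} (hF : z ∈ hexFaceVertices F) :
    faceLabel (cycDarts l) F = cellLabel (cycDarts l) z := by
  obtain ⟨k, rfl⟩ := exists_eq_leftFaceDir_of_mem hF
  exact faceLabel_leftFaceDir_eq_cellLabel hadj hz k

/-- **Adjacent cells off the chain have equal labels** (both contain the face left of the bond). [folklore] -/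
theorem cellLabel_eq_of_adj {l : List (Site 2)} (hadj : ∀ d ∈ cycDarts l, triGraph.Adj d.1 d.2)
    {z z' : Site 2} (h : triGraph.Adj z z') (hz : ∀ d ∈ cycDarts l, d.1 ≠ z ∧ d.2 ≠ z)
    (hz' : ∀ d ∈ cycDarts l, d.1 ≠ z' ∧ d.2 ≠ z') : cellLabel (cycDarts l) z = cellLabel (cycDarts l) z' := by
  have h1 : z ∈ hexFaceVertices (leftFace z z') := by rw [hexFaceVertices_leftFace h]; simp
  have h2 : z' ∈ hexFaceVertices (leftFace z z') := by rw [hexFaceVertices_leftFace h]; simp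
  rw [← faceLabel_eq_cellLabel_of_mem hadj hz h1, faceLabel_eq_cellLabel_of_mem hadj hz' h2]

/-- **Cell labels are constant along paths of sites off the chain** ("a path cannot start inside
and end outside a closed cycle", Bollobás–Riordan 2006, Ch. 5 p. 131). [cite: BollobasRiordan2006, Ch. 5, p. 131 (closed cycles of T separate inside from outside)] -/
theorem cellLabel_eq_of_pathIn {l : List (Site 2)} (hadj : ∀ d ∈ cycDarts l, triGraph.Adj d.1 d.2)
    {A : Set (Site 2)} (hA : ∀ z ∈ A, ∀ d ∈ cycDarts l, d.1 ≠ z ∧ d.2 ≠ z) {z z' : Site 2}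
    (h : PathIn triGraph A z z') : cellLabel (cycDarts l) z = cellLabel (cycDarts l) z' := by
  obtain ⟨hz, hR⟩ := h
  induction hR with
  | refl => rfl
  | @tail b c hab hbc ih =>
    rw [ih]
    exact cellLabel_eq_of_adj hadj hbc.1 (hA b (PathIn.right_mem ⟨hz, hab⟩)) (hA c hbc.2)

/-- **Far to the right the label vanishes**: if every dart of `D` has both endpoints in
`{x₀ ≤ z₀}` then the cell `z` has label `0`. [folklore] -/
theorem cellLabel_eq_zero_of_forall_le {D : List (Site 2 × Site 2)} {z : Site 2}
    (h : ∀ d ∈ D, d.1 0 ≤ z 0 ∧ d.2 0 ≤ z 0) : cellLabel D z = 0 := by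
  unfold cellLabel
  rw [faceLabel_up]
  refine dsum_eq_zero fun d hd => zind_of_neg fun hxy => ?_
  obtain ⟨h1, h2⟩ := h d hd
  unfold RayCross at hxy
  omega

/-! ### Darts of a list by index -/

/-- The number of darts of a list. [folklore] -/
theorem length_pathDarts : ∀ m : List (Site 2), (pathDarts m).length = m.length - 1
  | [] => rfl
  | [_] => rfl
  | a :: b :: t => by
    rw [pathDarts_cons_cons, List.length_cons, length_pathDarts (b :: t)]
    simp

/-- The `i`-th dart of a list joins its `i`-th and `(i+1)`-st entries. [folklore] -/
theorem getElem_pathDarts : ∀ (m : List (Site 2)) (i : ℕ) (hi : i < (pathDarts m).length),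
    (pathDarts m)[i] = (m[i]'(by rw [length_pathDarts] at hi; omega),
      m[i + 1]'(by rw [length_pathDarts] at hi; omega))
  | [], i, hi => by simp at hi
  | [_], i, hi => by simp at hi
  | a :: b :: t, 0, hi => by simp
  | a :: b :: t, i + 1, hi => by
    have hi' : i < (pathDarts (b :: t)).length := by
      rw [pathDarts_cons_cons, List.length_cons] at hi; omega
    have := getElem_pathDarts (b :: t) i hi'
    simp only [pathDarts_cons_cons, List.getElem_cons_succ]
    exact this

/-- A nonempty list has as many closed darts as entries. [folklore] -/
theorem length_cycDarts {l : List (Site 2)} (hl : l ≠ []) : (cycDarts l).length = l.length := by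
  cases l with
  | nil => exact absurd rfl hl
  | cons a t =>
    show (pathDarts (a :: t ++ [a])).length = (a :: t).length
    rw [length_pathDarts]; simp

/-- The `i`-th closed dart joins the `i`-th entry to the next one, cyclically. [folklore] -/
theorem getElem_cycDarts {l : List (Site 2)} (hl : l ≠ []) (i : ℕ) (hi : i < (cycDarts l).length) :
    (cycDarts l)[i] = (l[i]'(by rw [length_cycDarts hl] at hi; exact hi),
      l[(i + 1) % l.length]'(Nat.mod_lt _ (List.length_pos_iff.2 hl))) := by
  cases l with
  | nil => exact absurd rfl hl
  | cons a t =>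
    have hi' : i < (pathDarts (a :: t ++ [a])).length := hi
    have e := getElem_pathDarts (a :: t ++ [a]) i hi'
    have hlen : i < (a :: t).length := by rw [length_cycDarts hl] at hi; exact hi
    show (pathDarts (a :: t ++ [a]))[i] = _
    rw [e]
    congr 1
    · exact List.getElem_append_left hlen
    · by_cases hlast : i + 1 < (a :: t).length
      · rw [List.getElem_append_left hlast]
        congr 1
        exact (Nat.mod_eq_of_lt hlast).symm
      · have heq : i + 1 = (a :: t).length := by omega
        rw [List.getElem_append_right (by omega)]
        simp [heq]

/-- Membership in the closed darts, by index. [folklore] -/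
theorem mem_cycDarts_iff {l : List (Site 2)} (hl : l ≠ []) {d : Site 2 × Site 2} :
    d ∈ cycDarts l ↔ ∃ (i : ℕ) (hi : i < l.length),
      d = (l[i], l[(i + 1) % l.length]'(Nat.mod_lt _ (List.length_pos_iff.2 hl))) := by
  rw [List.mem_iff_getElem]
  constructor
  · rintro ⟨i, hi, rfl⟩
    exact ⟨i, by rw [length_cycDarts hl] at hi; exact hi, getElem_cycDarts hl i hi⟩
  · rintro ⟨i, hi, rfl⟩
    exact ⟨i, by rw [length_cycDarts hl]; exact hi, getElem_cycDarts hl i _⟩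

/-! ### Simple closed chains -/

/-- **A simple closed chain of `𝕋`** (a lattice cycle): a list of pairwise distinct sites, at
least three, consecutive ones — and the last and the first — adjacent. [folklore] -/
structure IsTriLoop (l : List (Site 2)) : Prop where
  /-- The sites are pairwise distinct. -/
  nodup : l.Nodup
  /-- There are at least three of them. -/
  three_le : 3 ≤ l.length
  /-- Consecutive sites, cyclically, are adjacent. -/
  adj : ∀ d ∈ cycDarts l, triGraph.Adj d.1 d.2

namespace IsTriLoop

variable {l : List (Site 2)} (h : IsTriLoop l)
include h

/-- A loop is a nonempty list. [folklore] -/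
theorem ne_nil : l ≠ [] := by
  intro e; have := h.three_le; rw [e] at this; simp at this

/-- The length of a loop is positive. [folklore] -/
theorem length_pos : 0 < l.length := by have := h.three_le; omega

/-- Consecutive indices carry consecutive closed darts. [folklore] -/
theorem mem_cycDarts_getElem (i : ℕ) (hi : i < l.length) :
    (l[i], l[(i + 1) % l.length]'(Nat.mod_lt _ h.length_pos)) ∈ cycDarts l :=
  (mem_cycDarts_iff h.ne_nil).2 ⟨i, hi, rfl⟩

/-- **The dart out of a site of the loop is unique.** [folklore] -/
theorem snd_eq_of_mem_of_mem {b y c : Site 2} (hy : (b, y) ∈ cycDarts l) (hc : (b, c) ∈ cycDarts l) :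
    y = c := by
  obtain ⟨i, hi, ei⟩ := (mem_cycDarts_iff h.ne_nil).1 hy
  obtain ⟨j, hj, ej⟩ := (mem_cycDarts_iff h.ne_nil).1 hc
  have hb : l[i] = l[j] := by
    have h1 := congrArg Prod.fst ei; have h2 := congrArg Prod.fst ej
    simp only at h1 h2; rw [← h1, ← h2]
  have hij : i = j := (h.nodup.getElem_inj_iff).1 hb
  subst hij
  have h1 := congrArg Prod.snd ei; have h2 := congrArg Prod.snd ej
  simp only at h1 h2; rw [h1, h2]

/-- **The dart into a site of the loop is unique.** [folklore] -/
theorem fst_eq_of_mem_of_mem {a y b : Site 2} (hy : (y, b) ∈ cycDarts l) (ha : (a, b) ∈ cycDarts l) :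
    y = a := by
  obtain ⟨i, hi, ei⟩ := (mem_cycDarts_iff h.ne_nil).1 hy
  obtain ⟨j, hj, ej⟩ := (mem_cycDarts_iff h.ne_nil).1 ha
  have hn := h.length_pos
  have hb : l[(i + 1) % l.length]'(Nat.mod_lt _ hn) = l[(j + 1) % l.length]'(Nat.mod_lt _ hn) := by
    have h1 := congrArg Prod.snd ei; have h2 := congrArg Prod.snd ej
    simp only at h1 h2; rw [← h1, ← h2]
  have hij : (i + 1) % l.length = (j + 1) % l.length := (h.nodup.getElem_inj_iff).1 hb
  have hij' : i = j := by
    have := Nat.ModEq.add_right_cancel' 1 hij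
    unfold Nat.ModEq at this
    rwa [Nat.mod_eq_of_lt hi, Nat.mod_eq_of_lt hj] at this
  subst hij'
  have h1 := congrArg Prod.fst ei; have h2 := congrArg Prod.fst ej
  simp only at h1 h2; rw [h1, h2]

/-- **A loop never traverses a bond in both directions** (it has at least three sites). [folklore] -/
theorem not_mem_swap {a b : Site 2} (hab : (a, b) ∈ cycDarts l) : (b, a) ∉ cycDarts l := by
  intro hba
  obtain ⟨i, hi, ei⟩ := (mem_cycDarts_iff h.ne_nil).1 hab
  obtain ⟨j, hj, ej⟩ := (mem_cycDarts_iff h.ne_nil).1 hba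
  have hn := h.length_pos
  set n := l.length with hn'
  have ha1 : a = l[i] := congrArg Prod.fst ei
  have hb1 : b = l[(i + 1) % n]'(Nat.mod_lt _ hn) := congrArg Prod.snd ei
  have hb2 : b = l[j] := congrArg Prod.fst ej
  have ha2 : a = l[(j + 1) % n]'(Nat.mod_lt _ hn) := congrArg Prod.snd ej
  have e1 : (i + 1) % n = j := (h.nodup.getElem_inj_iff).1 (hb1.symm.trans hb2) |>.trans (Nat.mod_eq_of_lt hj).symm |> fun e => by
    have := (h.nodup.getElem_inj_iff (hi := Nat.mod_lt _ hn) (hj := hj)).1 (hb1.symm.trans hb2)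
    exact this
  have e2 : (j + 1) % n = i := (h.nodup.getElem_inj_iff (hi := Nat.mod_lt _ hn) (hj := hi)).1 (ha2.symm.trans ha1)
  -- `i + 2 ≡ i (mod n)` with `n ≥ 3`
  have h3 := h.three_le
  rw [← e1] at e2
  by_cases hi1 : i + 1 < n
  · rw [Nat.mod_eq_of_lt hi1] at e2
    by_cases hi2 : i + 2 < n
    · rw [Nat.mod_eq_of_lt hi2] at e2; omega
    · have : i + 1 + 1 = n := by omega
      rw [this, Nat.mod_self] at e2; omega
  · have : i + 1 = n := by omega
    rw [this, Nat.mod_self] at e2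
    rw [Nat.mod_eq_of_lt (by omega)] at e2; omega

/-- **Every bond of the loop has multiplicity one.** [folklore] -/
theorem lbond_eq_one {a b : Site 2} (hab : (a, b) ∈ cycDarts l) : lbond (cycDarts l) a b = 1 := by
  obtain ⟨D₁, D₂, hD⟩ := List.append_of_mem hab
  have hnd : (cycDarts l).Nodup := by
    have : ((cycDarts l).map Prod.fst).Nodup := by
      cases l with
      | nil => exact absurd rfl h.ne_nil
      | cons x t =>
        show ((pathDarts (x :: t ++ [x])).map Prod.fst).Nodup
        rw [map_fst_pathDarts, List.dropLast_concat]; exact h.nodup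
    exact this.of_map _
  rw [hD] at hnd
  have hnot : (a, b) ∉ D₁ ++ D₂ := by
    have := List.nodup_append.1 (show (D₁ ++ [(a, b)] ++ D₂).Nodup by simpa using hnd)
    intro hm
    rw [List.mem_append] at hm
    rcases hm with hm | hm
    · have h1 := (List.nodup_append.1 this.1).2.2 _ hm _ (List.mem_singleton_self _)
      exact h1 rfl
    · exact this.2.2 _ (List.mem_append_right _ (List.mem_singleton_self _)) _ hm rfl
  have hswap := h.not_mem_swap hab
  unfold lbond dsum
  rw [hD, List.map_append, List.map_cons, List.sum_append, List.sum_cons]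
  have hz : ∀ d ∈ D₁ ++ D₂, zind (s(d.1, d.2) = s(a, b)) = 0 := by
    intro d hd
    refine zind_of_neg fun he => ?_
    rcases Sym2.eq_iff.1 he with ⟨h1, h2⟩ | ⟨h1, h2⟩
    · exact hnot (by rw [show d = (a, b) from Prod.ext h1 h2] at hd; exact hd)
    · exact hswap (by rw [hD]; rw [show d = (b, a) from Prod.ext h1 h2] at hd
                      rcases List.mem_append.1 hd with hd | hd
                      · exact List.mem_append.2 (Or.inl hd)
                      · exact List.mem_append.2 (Or.inr (List.mem_cons_of_mem _ hd)))
  have hz1 : (D₁.map fun d => zind (s(d.1, d.2) = s(a, b))).sum = 0 :=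
    List.sum_eq_zero fun x hx => by
      obtain ⟨d, hd, rfl⟩ := List.mem_map.1 hx; exact hz d (List.mem_append_left _ hd)
  have hz2 : (D₂.map fun d => zind (s(d.1, d.2) = s(a, b))).sum = 0 :=
    List.sum_eq_zero fun x hx => by
      obtain ⟨d, hd, rfl⟩ := List.mem_map.1 hx; exact hz d (List.mem_append_right _ hd)
  rw [hz1, hz2]
  show 0 + (zind (s(a, b) = s(a, b)) + 0) = 1
  rw [zind_of_pos rfl]; decide

end IsTriLoop

/-! ### Left faces of darts, by direction -/

/-- The left face of the dart `u → u + triDir k` is `leftFaceDir u k`. [folklore] -/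
theorem leftFace_add_triDir (u : Site 2) (k : Fin 6) : leftFace u (u + triDir k) = leftFaceDir u k := by
  rw [leftFace, dirOf_add_triDir]

/-- **The left face of a dart into `b` from the direction `α`** is the face at `b` between the
directions `α + 5` and `α` (it contains `b + triDir α`, `b` and `b + triDir (α + 5)`). [folklore] -/
theorem leftFace_add_triDir_rev (b : Site 2) (α : Fin 6) : leftFace (b + triDir α) b = leftFaceDir b (α + 5) := by
  have hb : b = b + triDir α + triDir (α + 3) := by rw [triDir_add_three]; abel
  have hd : dirOf (b + triDir α) b = α + 3 := by
    nth_rw 2 [hb]; rw [dirOf_add_triDir]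
  rw [leftFace, hd, leftFaceDir_eq_add (b + triDir α), leftFaceDir_eq_add b]
  have key : ∀ α : Fin 6, triDir α + (leftFaceDir 0 (α + 3)).1 = (leftFaceDir 0 (α + 5)).1 ∧
      (leftFaceDir 0 (α + 3)).2 = (leftFaceDir 0 (α + 5)).2 := by decide
  obtain ⟨k1, k2⟩ := key α
  rw [add_assoc, k1, k2]

/-- **The left face of a reversed side of a face is the opposite face**: for the anticlockwise
vertices `x_j` of `w`, the left face of the dart `x_{j+2} → x_{j+1}` is the dual neighbour of `w`
across that side. [folklore] -/
theorem leftFace_faceVertex_rev (w : HexVertex) (j : Fin 3) :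
    leftFace (faceVertex w (j + 2)) (faceVertex w (j + 1)) = oppFace w j := by
  have e : j + 1 + 1 = j + 2 := by rw [add_assoc]; rfl
  have h1 : faceVertex w (j + 1) = faceVertex w (j + 2) + triDir (faceDartDir w (j + 1) + 3) := by
    rw [triDir_add_three, ← e, faceVertex_succ w (j + 1)]; abel
  rw [h1, leftFace_add_triDir]
  rcases w with ⟨x, t⟩
  by_cases ht : t = 0
  · subst ht
    fin_cases j <;> simp [faceVertex, faceDartDir, leftFaceDir, oppFace]
  · obtain rfl : t = 1 := by
      rcases Fin.exists_fin_two.1 ⟨t, rfl⟩ with h' | h'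
      · exact (ht h').elim
      · exact h'
    fin_cases j <;> simp [faceVertex, faceDartDir, leftFaceDir, oppFace, add_sub_assoc, add_assoc]

/-! ### The two sides of a loop -/

/-- **The left label of a loop**: the label of the face to the left of its first dart
(`0` for lists with fewer than two entries). [folklore] -/
noncomputable def leftLabel (l : List (Site 2)) : ZMod 2 :=
  if h : 1 < l.length then faceLabel (cycDarts l) (leftFace (l[0]'(by omega)) (l[1]'h)) else 0

namespace IsTriLoop

variable {l : List (Site 2)} (h : IsTriLoop l)
include h

/-- **Turning at a site of the loop**: the faces to the left of the dart into `b` and of the dart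
out of `b` have equal labels — rotating about `b` from one to the other crosses only bonds at `b`
other than the two bonds of the loop, all of multiplicity `0`. [folklore] -/
theorem faceLabel_leftFace_in_eq_out {a b c : Site 2} (hab : (a, b) ∈ cycDarts l) (hbc : (b, c) ∈ cycDarts l) :
    faceLabel (cycDarts l) (leftFace a b) = faceLabel (cycDarts l) (leftFace b c) := by
  have hadj := h.adj
  -- directions of `a` and `c` from `b`
  set α := dirOf b a with hα
  set γ := dirOf b c with hγ
  have ha : a = b + triDir α := eq_add_triDir_dirOf (hadj _ hab).symm
  have hc : c = b + triDir γ := eq_add_triDir_dirOf (hadj _ hbc)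
  have hLa : leftFace a b = leftFaceDir b (α + 5) := by rw [ha, leftFace_add_triDir_rev]
  have hLc : leftFace b c = leftFaceDir b γ := by rw [hc, leftFace_add_triDir]
  rw [hLa, hLc]
  -- the offset `t` of `α + 5` from `γ`
  obtain ⟨tF, htF⟩ := RemovableAt.exists_offset γ (α + 5)
  set t : ℕ := tF.val with ht
  have ht5 : t ≤ 5 := by have := tF.isLt; omega
  have htF' : α + 5 = γ + Fin.ofNat 6 t := by rw [htF, ht, fin6_ofNat_val]
  rw [htF']
  -- bonds at `b` in the directions `γ + s`, `1 ≤ s ≤ t`, are not bonds of the loop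
  have hbond : ∀ s : ℕ, 1 ≤ s → s ≤ t → lbond (cycDarts l) b (b + triDir (γ + Fin.ofNat 6 s)) = 0 := by
    intro s hs1 hst
    refine lbond_eq_zero_of_forall_sym2_ne fun d hd he => ?_
    rcases Sym2.eq_iff.1 he with ⟨h1, h2⟩ | ⟨h1, h2⟩
    · -- `d = (b, y)`: then `y = c`, direction `γ`
      have hy : d.2 = c := h.snd_eq_of_mem_of_mem (by rw [← h1]; exact hd) hbc
      rw [hy, hc] at h2
      have hdir : γ = γ + Fin.ofNat 6 s := triDir_injective (add_left_cancel h2)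
      have : (Fin.ofNat 6 s).val = 0 := by
        have := congrArg Fin.val hdir
        simp only [Fin.val_add] at this
        have hlt := (Fin.ofNat 6 s).isLt
        omega
      rw [RemovableAt.val_ofNat_of_le (by omega)] at this
      omega
    · -- `d = (y, b)`: then `y = a`, direction `α`
      have hy : d.1 = a := h.fst_eq_of_mem_of_mem (by rw [← h2]; exact hd) hab
      rw [hy, ha] at h1
      have hdir : α = γ + Fin.ofNat 6 s := triDir_injective (add_left_cancel h1)
      have e5 : α + 5 = γ + Fin.ofNat 6 s + 5 := by rw [hdir]
      rw [htF'] at e5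
      have := congrArg Fin.val e5
      simp only [Fin.val_add] at this
      rw [RemovableAt.val_ofNat_of_le ht5, RemovableAt.val_ofNat_of_le (show s ≤ 5 by omega)] at this
      omega
  -- rotate
  have key : ∀ n : ℕ, n ≤ t → faceLabel (cycDarts l) (leftFaceDir b (γ + Fin.ofNat 6 n)) =
      faceLabel (cycDarts l) (leftFaceDir b γ) := by
    intro n hn
    induction n with
    | zero => rw [fin6_ofNat_zero, add_zero]
    | succ n ih =>
      rw [← ih (by omega), fin6_ofNat_succ, ← add_assoc]
      refine (faceLabel_eq_of_adj hadj (hexGraph_adj_leftFaceDir_succ b _) fun x y hxy => ?_).symm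
      rw [faceEdge_leftFaceDir_succ, add_assoc, ← fin6_ofNat_succ] at hxy
      have hb0 := hbond (n + 1) (by omega) hn
      -- `{x, y} = {b, b + triDir (γ + (n+1))}`
      have hx : x ∈ ({b, b + triDir (γ + Fin.ofNat 6 (n + 1))} : Finset (Site 2)) := by rw [hxy]; simp
      have hy : y ∈ ({b, b + triDir (γ + Fin.ofNat 6 (n + 1))} : Finset (Site 2)) := by rw [hxy]; simp
      have hne : x ≠ y := by
        intro hxy'
        have hcard : ({b, b + triDir (γ + Fin.ofNat 6 (n + 1))} : Finset (Site 2)).card = 2 :=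
          card_pair (add_triDir_ne b _).symm
        rw [hxy, hxy', Finset.pair_eq_singleton, card_singleton] at hcard
        exact absurd hcard (by norm_num)
      simp only [Finset.mem_insert, Finset.mem_singleton] at hx hy
      rcases hx with rfl | rfl <;> rcases hy with rfl | rfl
      · exact absurd rfl hne
      · exact hb0
      · rw [lbond_comm]; exact hb0
      · exact absurd rfl hne
  exact key t le_rfl

/-- The first two entries of the loop form its first dart. [folklore] -/
theorem mem_cycDarts_zero_one : (l[0]'h.length_pos, l[1]'(by have := h.three_le; omega)) ∈ cycDarts l := by
  have := h.mem_cycDarts_getElem 0 h.length_pos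
  have e : (0 + 1) % l.length = 1 := Nat.mod_eq_of_lt (by have := h.three_le; omega)
  simp only [e] at this
  exact this

/-- The left label of a loop is the label of the face left of its first dart. [folklore] -/
theorem leftLabel_eq : leftLabel l = faceLabel (cycDarts l) (leftFace (l[0]'h.length_pos) (l[1]'(by have := h.three_le; omega))) := by
  unfold leftLabel
  rw [dif_pos (by have := h.three_le; omega)]

/-- **All faces to the left of the loop have the left label** (turn at each site in order). [folklore] -/
theorem faceLabel_leftFace {d : Site 2 × Site 2} (hd : d ∈ cycDarts l) :
    faceLabel (cycDarts l) (leftFace d.1 d.2) = leftLabel l := by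
  have hn := h.length_pos
  have h3 := h.three_le
  -- by induction on the index of the dart
  have key : ∀ k : ℕ, ∀ hk : k < l.length,
      faceLabel (cycDarts l) (leftFace l[k] (l[(k + 1) % l.length]'(Nat.mod_lt _ hn))) = leftLabel l := by
    intro k
    induction k with
    | zero =>
      intro hk
      rw [h.leftLabel_eq]
      have e : (0 + 1) % l.length = 1 := Nat.mod_eq_of_lt (by omega)
      simp only [e]
    | succ k ih =>
      intro hk
      have hk' : k < l.length := by omega
      rw [← ih hk']
      have e1 : (k + 1) % l.length = k + 1 := Nat.mod_eq_of_lt hk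
      have hab := h.mem_cycDarts_getElem k hk'
      have hbc := h.mem_cycDarts_getElem (k + 1) hk
      simp only [e1] at hab ⊢
      exact (h.faceLabel_leftFace_in_eq_out hab hbc).symm
  obtain ⟨i, hi, rfl⟩ := (mem_cycDarts_iff h.ne_nil).1 hd
  exact key i hi

/-- **All faces to the right of the loop have the other label**: the face to the right of a dart
(the left face of the reversed dart) has label `leftLabel + 1`, the bond having multiplicity one. [folklore] -/
theorem faceLabel_rightFace {d : Site 2 × Site 2} (hd : d ∈ cycDarts l) :
    faceLabel (cycDarts l) (leftFace d.2 d.1) = leftLabel l + 1 := by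
  rw [← h.faceLabel_leftFace hd]
  set w := leftFace d.1 d.2 with hw
  obtain ⟨j, h1, h2⟩ := exists_eq_faceVertex_of_adj (h.adj d hd)
  have e1 : j + 2 + 2 = j + 1 := by rw [add_assoc]; congr 1
  have e2 : j + 2 + 1 = j := by rw [add_assoc]; exact add_eq_left.2 (by decide)
  have hrev : leftFace d.2 d.1 = oppFace w (j + 2) := by
    have := leftFace_faceVertex_rev w (j + 2)
    rw [e1, e2] at this
    have h1' : d.1 = faceVertex w j := h1
    have h2' : d.2 = faceVertex w (j + 1) := h2
    rw [h1', h2']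
    exact this
  have hrule := faceLabel_add_faceLabel_oppFace h.adj w (j + 2)
  rw [e2, e1, ← h1, ← h2, h.lbond_eq_one (by rw [Prod.mk.eta]; exact hd)] at hrule
  rw [hrev]
  have key : ∀ a b : ZMod 2, a + b = 1 → b = a + 1 := by decide
  exact key _ _ hrule

/-- The two sides have different labels. [folklore] -/
theorem faceLabel_leftFace_ne_rightFace {d : Site 2 × Site 2} (hd : d ∈ cycDarts l) :
    faceLabel (cycDarts l) (leftFace d.1 d.2) ≠ faceLabel (cycDarts l) (leftFace d.2 d.1) := by
  rw [h.faceLabel_leftFace hd, h.faceLabel_rightFace hd]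
  have key : ∀ a : ZMod 2, a ≠ a + 1 := by decide
  exact key _

end IsTriLoop

/-! ### The chain of outer heads along the boundary of a discrete domain -/

namespace TriMarkedDomain

variable {k : ℕ}

/-- The head (outside endpoint) of the boundary dart at position `n`. [folklore] -/
def bdryHead (D : TriMarkedDomain k) (n : ℕ) : Site 2 := (triBdryIter D.verts D.base n).2

/-- **The chain of outer heads over the positions `m, …, m + n`** of the boundary cycle, with
consecutive repetitions removed: the outer boundary sites seen along that stretch of the
boundary, in order (consecutive heads are equal — head-keeping step — or adjacent — tail-keeping
step, the head turning about the tail). [folklore] -/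
def headsList (D : TriMarkedDomain k) (m : ℕ) : ℕ → List (Site 2)
  | 0 => [D.bdryHead m]
  | n + 1 => if D.bdryHead (m + n + 1) = D.bdryHead (m + n) then headsList D m n
      else headsList D m n ++ [D.bdryHead (m + n + 1)]

/-- `headsList m 0 = [head m]`. [folklore] -/
@[simp] theorem headsList_zero (D : TriMarkedDomain k) (m : ℕ) : D.headsList m 0 = [D.bdryHead m] := rfl

/-- The recursion step of `headsList`. [folklore] -/
theorem headsList_succ (D : TriMarkedDomain k) (m n : ℕ) : D.headsList m (n + 1) =
    if D.bdryHead (m + n + 1) = D.bdryHead (m + n) then D.headsList m n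
      else D.headsList m n ++ [D.bdryHead (m + n + 1)] := rfl

/-- The chain of heads is nonempty. [folklore] -/
theorem headsList_ne_nil (D : TriMarkedDomain k) (m n : ℕ) : D.headsList m n ≠ [] := by
  induction n with
  | zero => simp
  | succ n ih => rw [headsList_succ]; split_ifs <;> simp [ih]

/-- The chain of heads starts at the head of position `m`. [folklore] -/
theorem head_headsList (D : TriMarkedDomain k) (m n : ℕ) :
    (D.headsList m n).head (D.headsList_ne_nil m n) = D.bdryHead m := by
  induction n with
  | zero => rfl
  | succ n ih =>
    simp only [headsList_succ]
    split_ifs with hc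
    · exact ih
    · rw [List.head_append_of_ne_nil]; exact ih

/-- The chain of heads ends at the head of position `m + n`. [folklore] -/
theorem getLast_headsList (D : TriMarkedDomain k) (m n : ℕ) :
    (D.headsList m n).getLast (D.headsList_ne_nil m n) = D.bdryHead (m + n) := by
  induction n with
  | zero => rfl
  | succ n ih =>
    simp only [headsList_succ]
    split_ifs with hc
    · rw [ih, ← hc, add_assoc]
    · rw [List.getLast_append_of_right_ne_nil _ _ (List.cons_ne_nil _ _)]; simp [add_assoc]

/-- The entries of the chain of heads are heads of positions in the range. [folklore] -/
theorem mem_headsList_iff (D : TriMarkedDomain k) (m n : ℕ) {o : Site 2} :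
    o ∈ D.headsList m n ↔ ∃ j, j ≤ n ∧ D.bdryHead (m + j) = o := by
  induction n with
  | zero =>
    simp only [headsList_zero, List.mem_singleton]
    constructor
    · rintro rfl; exact ⟨0, le_rfl, by rw [add_zero]⟩
    · rintro ⟨j, hj, rfl⟩
      obtain rfl : j = 0 := by omega
      rw [add_zero]
  | succ n ih =>
    rw [headsList_succ]
    split_ifs with hc
    · rw [ih]
      constructor
      · rintro ⟨j, hj, rfl⟩; exact ⟨j, by omega, rfl⟩
      · rintro ⟨j, hj, rfl⟩
        by_cases hjn : j ≤ n
        · exact ⟨j, hjn, rfl⟩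
        · obtain rfl : j = n + 1 := by omega
          exact ⟨n, le_rfl, by rw [← add_assoc, hc]⟩
    · rw [List.mem_append, ih, List.mem_singleton]
      constructor
      · rintro (⟨j, hj, rfl⟩ | rfl)
        · exact ⟨j, by omega, rfl⟩
        · exact ⟨n + 1, le_rfl, by rw [← add_assoc]⟩
      · rintro ⟨j, hj, rfl⟩
        by_cases hjn : j ≤ n
        · exact Or.inl ⟨j, hjn, rfl⟩
        · obtain rfl : j = n + 1 := by omega
          exact Or.inr (by rw [← add_assoc])

/-- **The chord loop of a path closed along the outside of the boundary**: the sites of the path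
`Q` followed by the chain of outer heads over the positions `nᵥ, …, nᵥ + len`; read cyclically,
its last dart returns from the last head to the first site of `Q` (the user arranges `Q` to run
from the tail of position `nᵥ + len` to the tail of position `nᵥ`). [folklore] -/
def chordLoop (D : TriMarkedDomain k) (Q : List (Site 2)) (nv len : ℕ) : List (Site 2) := Q ++ D.headsList nv len

end TriMarkedDomain

end Literature.Probability.Percolation
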